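import Literature.NumberTheory.EllipticCurves.Kato2004.IwasawaH2FineSelmerDualComparison
import Literature.NumberTheory.EllipticCurves.Kato2004.StrictSelmerH2Count
import Literature.NumberTheory.EllipticCurves.Sha
import HarnessLib

/-!
# Kato 2004 (Astérisque 295): `𝐇²_Γ(T_pW) ⊇ X₀(E/ℚ_∞)` with finite cokernel AND the order of its
# coinvariants `#(𝐇²_Γ)_Γ · #W(ℚ)[p^∞] = #Sel_str(ℚ, W[p^∞]) · #W(ℚ_p)[p^∞]` ((14.14.2) + (14.9.3)) — ONE named
# fact, the one-clause SEQUEL "H2X⁺" of `exists_iwasawaH2Data_fineSelmerDual_embedding` (H2X), and its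
# proved corollaries (H2X⁺ → H2X; the divisibility consumer shape)

Topic `NumberTheory/EllipticCurves`, sub-directory `Kato2004` (namespace = path). ONE `def … : Prop` (named fact,
review-queued, net debt +1), theorems otherwise; no instance, no notation, no `sorry`. Seat `bsd-potss-rkm`
(generation 30, prover, cell `bsd-potss`; crux M = item stmt-BirchSwinnertonDyer-19196 `ReducibleKatoMember` of the routes
K9 / K8-t′), minted in the shared `Kato2004/` namespace on the `bsd-cm` planner's typing guidance D455 (pub/bsd-potss
INBOX 2026-08-28T19:06:48Z: (α) Literature is append-only ⇒ a sequel named fact in a NEW module importing H2X's file;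
(γ) review lane; (δ) first announce owns — announced on pub/bsd-potss/STATUS 2026-08-28T22:51Z). HONEST FRAMING: BSD is
not advanced by this file; nothing about Kato's Main Conjecture is asserted; the fact is a CONSTRUCTION fact about Kato's
genuine `𝐇²_Γ(T_pW)` (as H2X and `nonempty_iwasawaH2Data` are), never stronger than print.

## Why a sequel (what the extra clause is for)

H2X (`IwasawaH2FineSelmerDualComparison.lean`, cell `bsd-cm`, p624791) transcribes, for `p` odd, `κ` cyclotomic and
`W(ℚ_{p,∞})[p^∞]` finite: there is a descent package `J : IwasawaH2Data W p κ γ I` (Kato's `𝐇²_Γ(T_pW)` with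
(12.2.1), Thm. 12.4 (1) and the exact sequence (14.14.1) pinned to `proj₀`) TOGETHER WITH an injection
`X₀(E/ℚ_∞) = (W.fineSelmerDualData κ hγ).X ↪ J.H2` of finite cokernel ((14.9.1) in the limit). The SAME printed object
`𝐇²(T)` satisfies ONE MORE printed statement that H2X forgets and that the crux-M package `MemberHullZetaCoreInputs`
(p630270) carries as its clause (c2′) `katoH2Count` for an ABSTRACT `H2`:

  (14.14.2) (p. 243) "`𝐇²(T)/𝔞𝐇²(T) ≅ H²(ℤ[1/p], T)`" (`𝔞` a generator of `𝔭 = Ker(Λ → O_λ, G_∞ ↦ 1)`),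

combined with the order of `H²(ℤ[1/p], T_pW)` read through Kato's Poitou–Tate sequence (14.9.3) (p. 240; "exact in the
case `p ≠ 2`") and local Tate duality at `p` — the tree's predicate `KatoH2CountAt W p n :
n · #W(ℚ)[p^∞] = #katoStrictSelmer W p {v_p} · #W(ℚ_p)[p^∞]` (`StrictSelmerH2Count.lean`, whose module docstring
derives the count: the cokernel of `H¹(ℤ[1/p],T)/H¹_f → H¹(ℚ_p,T)/H¹_f` is dual to `S(T)/Sel_str`,
`#H²(ℚ_p,T_pW) = #W(ℚ_p)[p^∞]`, `#H⁰(ℚ,W[p^∞]) = #W(ℚ)[p^∞]`; the identity is between FINITE cardinals when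
`Sel_str(ℚ,W[p^∞])` is finite, i.e. when `W(ℚ)` and `Ш(W)[p^∞]` are finite — the GUARD of the clause below, exactly the
scope stated in `KatoH2CountAt`'s docstring). This file's fact H2X⁺ is H2X's text VERBATIM with the clause
`Finite W(ℚ) → Finite Ш(W)[p^∞] → KatoH2CountAt W p #(J.H2)_Γ` added INSIDE the same existential — it is the coupling
of the count to THE `J` containing `X₀` that the consumers need (a count for "some other" package would be useless),
and it is print-exact because both statements are about the one printed module `𝐇²(T)` (on the `Δ`-trivial component,
READING (i) of `IwasawaH2Descent.lean`, as in H2X).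

CONSUMERS (Summits-side, seat rkm g29/g30): with the hull sub-package `MemberHullZetaFineInputs` of 27962 the clause
rebuilds 27962's abstract-`𝐇²` block (`Theorems/KatoDescentPotSupersingularMemberHullCoreInputsOfFine.lean`); in the
divisibility shape `#Sel_str · #W(ℚ_p)[p^∞] ∣ #(J.H2)_Γ · #W(ℚ)[p^∞]` (corollary `countDvd` below) it is the `hcount`
hypothesis of `ReducibleHullDescentCount.…_of_hull_of_countDvd` (p674069 §7–§8, crux M's printed inequality at `W` on
every reducible row). On the rows with `W(ℚ_p)[p] = 0` the clause is a KERNEL THEOREM for every `J ⊇ X₀` of finite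
cokernel (exact fine control, `ReducibleHullDescentCount.countDvd_of_noPTorsionPadic`, p674069 §9) — the fact is needed
only where `W(ℚ_p)[p] ≠ 0`.

## SCOPE of the fact (exactly H2X's, plus the guard of the count)

* `p ≠ 2`; `κ` CYCLOTOMIC with topological generator `γ`; `W(ℚ_{p,∞})[p^∞]` FINITE (the fixed points of
  `ker κ ⊓ D_v` on `W(ℚ̄)[p^∞]`, `v` the place at `p`) — HOLDS at every potentially good `p` (Imai 1975, NOT part of this
  fact) and FAILS for `p` odd exactly at Kato's (12.5.1); nothing is said there, at `p = 2`, or for non-cyclotomic `κ`.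
* The count clause is asserted only for `W(ℚ)` finite and `Ш(W)[p^∞]` finite (then `Sel_str`, `H²(ℤ[1/p],T)` and
  `(𝐇²_Γ)_Γ` are finite and (14.14.2) + (14.9.3) is an identity of natural numbers).
WEAKER than print (the maps to `𝐇²_{Γ,loc}`, the isomorphism (14.14.2) itself and the identity of `H2` are forgotten;
only "injective with finite cokernel" and the resulting COUNT are kept), never stronger. JUNK AUDIT: not vacuous (the
manufactured package of `IwasawaH2DataOfInjectivityProofs`, `H2` killed by `T`, has `#(H2)_Γ = #H2 = #A/ι(𝐇¹_Γ/T)`, which is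
not the strict Selmer count in general; a `J` padded by a finite module keeps H2X's clause but breaks the count); not
refutable by cooked data (an `∃`); consistent with H2X (corollary `embedding`).

## References

* K. Kato, Astérisque 295 (2004): 8.2 (p. 180), 12.2 (12.2.1)–(12.2.3) and the display after it (p. 220), Thm. 12.4 (1)
  (p. 221), (12.5.1) and Rem. 12.7 (p. 222), 13.8 (p. 228), §14.1 (p. 235), (14.9.1) (p. 239), (14.9.3) (p. 240), §14.14
  (14.14.1)–(14.14.2) (p. 243), proof of Prop. 14.16 (2) (p. 245), (17.13.1) (p. 279) — store key
  `paper:doi-10-24033-ast-639`, pp. 239–240, 243 re-read by this seat. [Kato2004Asterisque]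
* J. S. Milne, *Arithmetic Duality Theorems* (2006), I Cor. 2.3, Thm. 4.10. [MilneADT2006]
* H. Imai, Proc. Japan Acad. 51 (1975) 12–16, Theorem (p. 12). [Imai1975] (scope remark only)
* Tree: `Kato2004/IwasawaH2FineSelmerDualComparison.lean` (H2X, the fact this file sharpens; `lengthAt_eq_of_…`),
  `Kato2004/IwasawaH2Descent.lean` (`IwasawaH2Data`), `Kato2004/StrictSelmerH2Count.lean` (`katoStrictSelmer`, `KatoH2CountAt`),
  `Kato2004/MemberHullZetaCoreInputs.lean` (clause (c2′) `katoH2Count`, the abstract-`H2` form of the same statement),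
  `KatoFineSelmerDualProofs.lean` (`WeierstrassCurve.fineSelmerDualData`), `Sha.lean` (`WeierstrassCurve.sha`).
-/

noncomputable section

open scoped Classical NumberField
open Field IsDedekindDomain
open Literature.NumberTheory.GaloisRepresentations
open Literature.NumberTheory.EllipticCurves Literature.NumberTheory.EllipticCurves.IwasawaAlgebra
open Literature.NumberTheory.EllipticCurves.Module

namespace Literature.NumberTheory.EllipticCurves.Kato2004

/-! ## The named fact -/

/-- **Kato's `𝐇²_Γ(T_pW)` contains `X₀(E/ℚ_∞)` with finite cokernel, AND its coinvariants have the order of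
`H²(ℤ[1/p], T_pW)`: `#(𝐇²_Γ)_Γ · #W(ℚ)[p^∞] = #Sel_str(ℚ, W[p^∞]) · #W(ℚ_p)[p^∞]` (`p` odd, `W(ℚ_{p,∞})[p^∞]` finite;
the count for `W(ℚ)`, `Ш(W)[p^∞]` finite).** For an elliptic curve `W/ℚ`, an odd prime `p`, the CYCLOTOMIC
`ℤ_p`-extension `κ` with topological generator `γ`, the place `v` of `ℚ` at `p`, under the hypothesis that
`W(ℚ_{p,∞})[p^∞] = (W(ℚ̄)[p^∞])^{ker κ ⊓ D_v}` is finite, and for every pinned Iwasawa cohomology `I : IwasawaH1Data W p κ γ`: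
there is a descent package `J : IwasawaH2Data W p κ γ I` (Kato's `𝐇²_Γ(T_pW)` with (12.2.1), Thm. 12.4 (1), (14.14.1) pinned to
`proj₀`) TOGETHER WITH an injective `Λ`-linear map `X₀(E/ℚ_∞) = (W.fineSelmerDualData κ hγ).X → J.H2` of finite cokernel
((14.9.1) in the limit (17.13.1), read through the local duality after (12.2.3)) — VERBATIM the text of
`exists_iwasawaH2Data_fineSelmerDual_embedding` — AND, when `W(ℚ)` and `Ш(W)[p^∞]` are finite, the COUNT
`KatoH2CountAt W p #(J.H2)_Γ`, i.e. `#(J.H2/T·J.H2) · #W(ℚ)[p^∞] = #katoStrictSelmer W p {v_p} · #W(ℚ_p)[p^∞]`: the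
isomorphism (14.14.2) `𝐇²(T)/𝔞𝐇²(T) ≅ H²(ℤ[1/p], T)` followed by the order of `H²(ℤ[1/p], T_pW)` through the
Poitou–Tate sequence (14.9.3) and local Tate duality at `p` (the derivation recorded in `StrictSelmerH2Count.lean`).
The same clause as (c2′) `MemberHullZetaCoreInputs.katoH2Count`, here for the package CONTAINING `X₀`. A CONSTRUCTION
fact (review-queued); SCOPE and conventions: module docstring. Nothing is asserted at `p = 2`, for non-cyclotomic `κ`,
or when `W(ℚ_{p,∞})[p^∞]` is infinite (Kato (12.5.1)).
[cite: Kato2004Asterisque, (14.9.1) (p. 239), (14.9.3) (p. 240), §14.14 (14.14.1)–(14.14.2) (p. 243), 12.2 (12.2.1)–(12.2.3) (p. 220), Thm. 12.4 (1) (p. 221), 13.8 (p. 228), proof of Prop. 14.16 (2) (p. 245), (17.13.1) (p. 279)]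
[cite: MilneADT2006, Ch. I, Cor. 2.3 and Thm. 4.10] -/
def exists_iwasawaH2Data_fineSelmerDual_embedding_count : Prop :=
  ∀ (W : WeierstrassCurve ℚ) [W.IsElliptic] (p : ℕ) [Fact p.Prime] [ContinuousSMul ℤ_[p] (W.tateModule p)]
    (κ : ZpExtension ℚ p) (γ : absoluteGaloisGroup ℚ) (hγ : κ.IsTopGenerator γ)
    (v : HeightOneSpectrum (𝓞 ℚ)),
    p ≠ 2 → κ.IsCyclotomic → ((Rat.HeightOneSpectrum.primesEquiv v : Nat.Primes) : ℕ) = p →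
    Finite (FixedPoints.addSubgroup ↥(κ.kerSubgroup ⊓ GreenbergSelmer.decomp v) (W.geomPrimaryTorsion p)) →
    ∀ I : IwasawaH1Data W p κ γ,
      ∃ (J : IwasawaH2Data W p κ γ I) (e : (W.fineSelmerDualData κ hγ).X →ₗ[IwasawaAlgebra p] J.H2),
        Function.Injective e ∧ Finite (J.H2 ⧸ LinearMap.range e) ∧
          (Finite W.toAffine.Point → Finite (AddCommGroup.primaryComponent W.sha p) →
            KatoH2CountAt W p (Nat.card (coinvariants p J.H2)))

/-! ## Proved corollaries (the consumer shapes) -/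

section Corollaries

variable {W : WeierstrassCurve ℚ} [W.IsElliptic] {p : ℕ} [Fact p.Prime] [ContinuousSMul ℤ_[p] (W.tateModule p)]
  {κ : ZpExtension ℚ p} {γ : absoluteGaloisGroup ℚ}

/-- **H2X⁺ ⟹ H2X**: dropping the count clause gives `exists_iwasawaH2Data_fineSelmerDual_embedding` verbatim.
[cite: Kato2004Asterisque, (14.9.1) (p. 239), (14.14.1) (p. 243)] -/
theorem exists_iwasawaH2Data_fineSelmerDual_embedding_count.embedding
    (h : exists_iwasawaH2Data_fineSelmerDual_embedding_count) :
    exists_iwasawaH2Data_fineSelmerDual_embedding := by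
  intro W _ p _ _ κ γ hγ v hp hκ hv hfin I
  obtain ⟨J, e, he, hcok, -⟩ := h W p κ γ hγ v hp hκ hv hfin I
  exact ⟨J, e, he, hcok⟩

/-- **The package with the count, per pin** (`p` odd, `κ` cyclotomic, `W(ℚ_{p,∞})[p^∞]`, `W(ℚ)`, `Ш(W)[p^∞]` finite):
some `J ⊇ X₀` of finite cokernel has `#(J.H2)_Γ · #W(ℚ)[p^∞] = #Sel_str · #W(ℚ_p)[p^∞]`.
[cite: Kato2004Asterisque, (14.9.3) (p. 240), (14.14.2) (p. 243)] -/
theorem exists_iwasawaH2Data_fineSelmerDual_embedding_count.exists_count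
    (h : exists_iwasawaH2Data_fineSelmerDual_embedding_count) (hγ : κ.IsTopGenerator γ)
    (v : HeightOneSpectrum (𝓞 ℚ)) (hp : p ≠ 2) (hκ : κ.IsCyclotomic)
    (hv : ((Rat.HeightOneSpectrum.primesEquiv v : Nat.Primes) : ℕ) = p)
    (hfin : Finite (FixedPoints.addSubgroup ↥(κ.kerSubgroup ⊓ GreenbergSelmer.decomp v)
      (W.geomPrimaryTorsion p)))
    [Finite W.toAffine.Point] [Finite (AddCommGroup.primaryComponent W.sha p)]
    (I : IwasawaH1Data W p κ γ) :
    ∃ (J : IwasawaH2Data W p κ γ I) (e : (W.fineSelmerDualData κ hγ).X →ₗ[IwasawaAlgebra p] J.H2),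
      Function.Injective e ∧ Finite (J.H2 ⧸ LinearMap.range e) ∧
        Nat.card (coinvariants p J.H2) * Nat.card (AddCommGroup.primaryComponent W.toAffine.Point p) =
          Nat.card (katoStrictSelmer W p {primePlace p}) *
            Nat.card (AddCommGroup.primaryComponent
              (W.baseChange ((primePlace p).adicCompletion ℚ)).toAffine.Point p) := by
  obtain ⟨J, e, he, hcok, hc⟩ := h W p κ γ hγ v hp hκ hv hfin I
  exact ⟨J, e, he, hcok, (katoH2CountAt_iff W p _).mp (hc inferInstance inferInstance)⟩

/-- **The DIVISIBILITY consumer shape** (the `hcount` hypothesis of the crux-M ledger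
`ReducibleHullDescentCount.…_of_hull_of_countDvd`): per pin as above, some `J ⊇ X₀` of finite cokernel has
`#Sel_str(ℚ,W[p^∞]) · #W(ℚ_p)[p^∞] ∣ #(J.H2)_Γ · #W(ℚ)[p^∞]` (one direction of the count).
[cite: Kato2004Asterisque, (14.9.3) (p. 240), (14.14.2) (p. 243)] -/
theorem exists_iwasawaH2Data_fineSelmerDual_embedding_count.exists_countDvd
    (h : exists_iwasawaH2Data_fineSelmerDual_embedding_count) (hγ : κ.IsTopGenerator γ)
    (v : HeightOneSpectrum (𝓞 ℚ)) (hp : p ≠ 2) (hκ : κ.IsCyclotomic)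
    (hv : ((Rat.HeightOneSpectrum.primesEquiv v : Nat.Primes) : ℕ) = p)
    (hfin : Finite (FixedPoints.addSubgroup ↥(κ.kerSubgroup ⊓ GreenbergSelmer.decomp v)
      (W.geomPrimaryTorsion p)))
    [Finite W.toAffine.Point] [Finite (AddCommGroup.primaryComponent W.sha p)]
    (I : IwasawaH1Data W p κ γ) :
    ∃ (J : IwasawaH2Data W p κ γ I) (e : (W.fineSelmerDualData κ hγ).X →ₗ[IwasawaAlgebra p] J.H2),
      Function.Injective e ∧ Finite (J.H2 ⧸ LinearMap.range e) ∧
        Nat.card (katoStrictSelmer W p {primePlace p}) *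
            Nat.card (AddCommGroup.primaryComponent
              (W.baseChange ((primePlace p).adicCompletion ℚ)).toAffine.Point p) ∣
          Nat.card (coinvariants p J.H2) * Nat.card (AddCommGroup.primaryComponent W.toAffine.Point p) := by
  obtain ⟨J, e, he, hcok, hc⟩ := h.exists_count hγ v hp hκ hv hfin I
  exact ⟨J, e, he, hcok, dvd_of_eq hc.symm⟩

end Corollaries

end Literature.NumberTheory.EllipticCurves.Kato2004

end
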